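import Summits.MatrixMultiplication.OmegaCensus.STPPZoo313Checker
import Summits.MatrixMultiplication.OmegaCensus.STPPZoo313TableP4

/-!
# ω-census (abelian STPP census): certification rows of the (3,13)@61 two-above zoo — leaf ranges, part 84

HONEST FRAMING (pub-omega census; verbatim): lottery ticket; floor = certified bounds/negative ranges.
Census STRUCTURE (seat pub-omega-stpp-1 gen 33, 2026-08-29), family (b2).  Kernel rows for `zoo313_61_of_rows` (`STPPZoo313Theorem.lean`): the depth-first
zoo search `zooGo 61 zooTbl61 …` (`STPPZoo313Checker.lean`) split along the prefix tree of the difference sequence; sibling ranges of one node are decided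
in one `decide +kernel` (≤ 15 000 leaves each); node theorems glue their children (`List.range'_append`).  Generator: HOME
`pub-omega-stpp-1-g33/code/gen_zoo_rows.py`.  Nothing here is progress on `ω`.
-/

namespace Summit.MatrixMultiplication.OmegaCensus.CubeNB.S2

/-- Zoo rows: node [14, 1, 1, 1], children d ∈ [1, 17] (14892 leaves). [folklore] -/
theorem zooRow_r14_1_1_1_1_17 : ((List.range' 1 17).all fun d => cond (Nat.ble 2 d) (Nat.beq 2 0 || zooGo 61 zooTbl61 7 (42 - d) (2 - 1) (17 + d) (245761 ||| (1 <<< (17 + d))) ((17 + d) :: [17, 16, 15, 14, 0])) (zooGo 61 zooTbl61 7 (42 - d) 2 (17 + d) (245761 ||| (1 <<< (17 + d))) ((17 + d) :: [17, 16, 15, 14, 0]))) = true := by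
  decide +kernel

/-- Zoo rows: node [14, 1, 1, 1], children d ∈ [18, 35] (1089 leaves). [folklore] -/
theorem zooRow_r14_1_1_1_18_18 : ((List.range' 18 18).all fun d => cond (Nat.ble 2 d) (Nat.beq 2 0 || zooGo 61 zooTbl61 7 (42 - d) (2 - 1) (17 + d) (245761 ||| (1 <<< (17 + d))) ((17 + d) :: [17, 16, 15, 14, 0])) (zooGo 61 zooTbl61 7 (42 - d) 2 (17 + d) (245761 ||| (1 <<< (17 + d))) ((17 + d) :: [17, 16, 15, 14, 0]))) = true := by
  decide +kernel

/-- Zoo rows: node [14, 1, 1], children d ∈ [2, 35] (4522 leaves). [folklore] -/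
theorem zooRow_r14_1_1_2_34 : ((List.range' 2 34).all fun d => cond (Nat.ble 2 d) (Nat.beq 2 0 || zooGo 61 zooTbl61 8 (43 - d) (2 - 1) (16 + d) (114689 ||| (1 <<< (16 + d))) ((16 + d) :: [16, 15, 14, 0])) (zooGo 61 zooTbl61 8 (43 - d) 2 (16 + d) (114689 ||| (1 <<< (16 + d))) ((16 + d) :: [16, 15, 14, 0]))) = true := by
  decide +kernel

/-- Zoo rows: node [14, 1], children d ∈ [2, 35] (5083 leaves). [folklore] -/
theorem zooRow_r14_1_2_34 : ((List.range' 2 34).all fun d => cond (Nat.ble 2 d) (Nat.beq 2 0 || zooGo 61 zooTbl61 9 (44 - d) (2 - 1) (15 + d) (49153 ||| (1 <<< (15 + d))) ((15 + d) :: [15, 14, 0])) (zooGo 61 zooTbl61 9 (44 - d) 2 (15 + d) (49153 ||| (1 <<< (15 + d))) ((15 + d) :: [15, 14, 0]))) = true := by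
  decide +kernel

/-- Zoo rows: node [14], children d ∈ [2, 35] (5644 leaves). [folklore] -/
theorem zooRow_r14_2_34 : ((List.range' 2 34).all fun d => cond (Nat.ble 2 d) (Nat.beq 2 0 || zooGo 61 zooTbl61 10 (45 - d) (2 - 1) (14 + d) (16385 ||| (1 <<< (14 + d))) ((14 + d) :: [14, 0])) (zooGo 61 zooTbl61 10 (45 - d) 2 (14 + d) (16385 ||| (1 <<< (14 + d))) ((14 + d) :: [14, 0]))) = true := by
  decide +kernel

end Summit.MatrixMultiplication.OmegaCensus.CubeNB.S2
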